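import Summits.BirchSwinnertonDyer.BirchSwinnertonDyer.Theses.ResidualThetaTransportAtTwo
import Summits.BirchSwinnertonDyer.BirchSwinnertonDyer.Theorems.ResidualThetaTransportAtTwoSignedMuVanishingAtTwoPlusSel2
import Summits.BirchSwinnertonDyer.BirchSwinnertonDyer.Theorems.ResidualThetaTransportAtTwoSignedMuVanishingAtTwoPlusLineV42
import Literature.NumberTheory.EllipticCurves.Kobayashi2003.FineSelmerLeSignedSelmerProofs
import Literature.NumberTheory.EllipticCurves.Kobayashi2003.SignedSelmerDualExistsProofs
import Literature.NumberTheory.EllipticCurves.Kobayashi2003.SignedSelmerModuleFiniteProofs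
import HarnessLib

/-!
# Crux Kμ⁺ `SignedMuVanishingAtTwoPlus` (stmt-BirchSwinnertonDyer-20689) and its μ-seed 21438 FORCE residual
# Conjecture A at `2` on the habitat⁺: `Sel₀(W/ℚ_∞)[2]` finite for every habitat⁺ curve — the (F)-half is NECESSARY

Cell `bsd-wall`, lead `bsd-wall-rtt-p4` g8 (helper, `--supports stmt-BirchSwinnertonDyer-20689`; THEOREMS ONLY — no `def`, no
named fact, no `sorry`). BSD is not proved by this; nothing here proves the crux or the seed — these are NECESSITY transfers.

The crux-ideate memo `Cruxes/SignedMuSeedAtTwoPlus/SEED-FINE-HALF-CUBIC-MU-k1g8.md` (E1/E3) reads the seed crux 21438 as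
(F) ∧ (L) with (F) = «`Sel₀(ℚ_∞, W[2^∞])[2]` finite» (residual Conjecture A of Coates–Sujatha at `(W, 2)`; by E1 EXACTLY
Iwasawa's `μ₂ = 0` for the cyclotomic `ℤ₂`-extension of the cubic 2-division field `L_W`) and (L) the plus-local half. This
file certifies in the kernel the first half of E3: the seed — hence the crux Kμ⁺, which implies the seed with `A := W`
(`signedMuSeedAtTwoPlus_of_signedMuVanishingAtTwoPlus`, p583501) — IMPLIES (F) for every habitat⁺ curve and every cyclotomic
`κ`. Chain (all landed): seed ⟹ conjunct 1 of Kμ⁺ (`muAlgebraic_iff_signedMuSeedAtTwoPlus`, p585569, through the proved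
propagation at `2`) ⟹ `Sel⁺(W/ℚ_∞)[2]` finite (`muAlgebraic_iff_sel2Finite`, p583501; a finitely generated datum exists by
`Kobayashi2003.nonempty_signedSelmerDualData` + `SignedSelmerDualData.moduleFinite`) ⟹ `Sel₀(W/ℚ_∞)[2]` finite by the
tree lemma `Kobayashi2003.finite_fineSelmerInfty_pTorsion_of_finite_signedSelmerInfty_pTorsion` (`Sel₀ ≤ Sel^ε`, any sign).

* `fineResidualFinite_of_muAlgebraic_at` — per curve and `κ`: conjunct 1 of Kμ⁺ at `(W, κ, γ)` for all data ⟹ `Sel₀(W/ℚ_∞)[2]`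
  finite;
* `fineResidualFinite_of_signedMuSeedAtTwoPlus` — **item 21438 ⟹ (F) on the whole habitat⁺** (VERBATIM the text of
  `stub_fineResidualHabitatAtTwo` / `FineResidualHabitatAtTwo` of line `pt_trivial_half` and `sign_dichotomy` S4, inlined);
* `fineResidualFinite_of_signedMuVanishingAtTwoPlus` — **the crux Kμ⁺ ⟹ (F) on the whole habitat⁺**.

Consequence for the planners (not a kernel statement here): any barrier against (F) uniformly on the habitat⁺ — k1g8's
`ClassicalMuAtTwoNonAbelianCubic` (Iwasawa `μ₂ = 0` on the family of complex cubic fields with `2` totally ramified) — is a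
barrier against 21438 AND against Kμ⁺ 20689 as typed (no conductor bound). BSD is not proved by any of this.

References: [CoatesSujatha2005] J. Coates, R. Sujatha, Math. Ann. 331 (2005) Conj. A and §3; [Kobayashi2003] Def. 1.1, Thm.
1.2; [GreenbergVatsal2000] Thm. (1.4) p. 3; [Greenberg1999LNM] §1 p. 60, Conj. 1.11.
-/

set_option autoImplicit false
-- justification: the `Summit.BirchSwinnertonDyer.BirchSwinnertonDyer.…` path repeats a component (route-file convention)
set_option linter.dupNamespace false

noncomputable section

open scoped Classical

open WeierstrassCurve Literature.NumberTheory.EllipticCurves Literature.NumberTheory.EllipticCurves.Rank1Residual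
  Literature.NumberTheory.EllipticCurves.Kobayashi2003 ZpExtension
  Summit.BirchSwinnertonDyer.BirchSwinnertonDyer.Theses.ResidualThetaTransportAtTwo

namespace Summit.BirchSwinnertonDyer.BirchSwinnertonDyer.Theorems.SignedMuAtTwo

/-- **Per curve and `κ`: conjunct 1 of Kμ⁺ at `(W, κ, γ)` ⟹ `Sel₀(W/ℚ_∞)[2]` finite.** If every finitely generated `+` signed
Selmer dual datum at `(W, κ, γ)` is `Λ`-torsion with `μ = 0`, then — a finitely generated datum existing
(`nonempty_signedSelmerDualData`, `SignedSelmerDualData.moduleFinite`) — `Sel⁺(W/ℚ_∞)[2]` is finite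
(`isTorsion_and_mu_eq_zero_iff_finite_selmer_pTorsion`), hence so is `Sel₀(W/ℚ_∞)[2]`
(`finite_fineSelmerInfty_pTorsion_of_finite_signedSelmerInfty_pTorsion`).
[cite: GreenbergVatsal2000, p. 3 (proof of Thm. (1.4))] [cite: Kobayashi2003, Thm. 1.2] -/
theorem fineResidualFinite_of_muAlgebraic_at (W : WeierstrassCurve ℚ) [W.IsElliptic] (κ : ZpExtension ℚ 2)
    {γ : Field.absoluteGaloisGroup ℚ} (hγ : κ.IsTopGenerator γ)
    (h : ∀ (D : SignedSelmerDualData W κ γ 1) [Module.Finite (IwasawaAlgebra 2) D.X],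
      Module.IsTorsion (IwasawaAlgebra 2) D.X ∧ D.mu = 0) :
    {s : W.fineSelmerInfty κ | 2 • s = 0}.Finite := by
  obtain ⟨D⟩ := nonempty_signedSelmerDualData (W := W) (κ := κ) (ε := 1) hγ
  haveI : Module.Finite (IwasawaAlgebra 2) D.X := SignedSelmerDualData.moduleFinite hγ D
  exact finite_fineSelmerInfty_pTorsion_of_finite_signedSelmerInfty_pTorsion (W := W) (κ := κ) 1
    ((isTorsion_and_mu_eq_zero_iff_finite_selmer_pTorsion D).mp (h D))

/-- **The μ-seed item 21438 `SignedMuSeedAtTwoPlus` FORCES residual Conjecture A at `2` on the habitat⁺**: for every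
habitat⁺ curve `W` (non-CM, analytic rank `0`, good supersingular at `2`, `a₂ = 0`, `Δ_W < 0`) and every cyclotomic
`ℤ₂`-extension `κ`, `Sel₀(W/ℚ_∞)[2]` is finite — VERBATIM the (F)-stub `FineResidualHabitatAtTwo` of the seed's lines
`pt_trivial_half` / `sign_dichotomy` (inlined). The seed gives conjunct 1 of Kμ⁺ through the proved propagation at `2`
(`muAlgebraic_iff_signedMuSeedAtTwoPlus`). So (F) is NECESSARY for the seed; by k1g8's E1 it is Iwasawa's `μ₂ = 0` for the
cubic 2-division field `L_W`. BSD is not proved by this. [cite: CoatesSujatha2005, Conj. A and §3] [cite: Greenberg1999LNM, Conj. 1.11] -/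
theorem fineResidualFinite_of_signedMuSeedAtTwoPlus (hSeed : SignedMuSeedAtTwoPlus) :
    ∀ (W : WeierstrassCurve ℚ) [W.IsElliptic] [W.IsGloballyMinimal], ¬ W.HasCM → W.analyticRank = 0 →
      GoodSS W 2 → W.frobeniusTrace 2 = 0 → W.Δ < 0 →
      ∀ (κ : ZpExtension ℚ 2), κ.IsCyclotomic → {s : W.fineSelmerInfty κ | 2 • s = 0}.Finite := by
  intro W _ _ hCM hr hss ha hΔ κ hκ
  obtain ⟨γ, hγ⟩ := κ.surjective (Multiplicative.ofAdd 1)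
  have hγ' : κ.IsTopGenerator γ := hγ
  exact fineResidualFinite_of_muAlgebraic_at W κ hγ'
    (fun D _ ↦ (muAlgebraic_iff_signedMuSeedAtTwoPlus.mpr hSeed) W hCM hr hss ha hΔ κ γ hκ hγ' D)

/-- **The crux Kμ⁺ `SignedMuVanishingAtTwoPlus` FORCES residual Conjecture A at `2` on the habitat⁺** (through the seed,
`A := W`: `signedMuSeedAtTwoPlus_of_signedMuVanishingAtTwoPlus`). Hence every obstruction to (F) uniformly on the habitat⁺ is an
obstruction to the crux as typed (no conductor bound). BSD is not proved by this.
[cite: CoatesSujatha2005, Conj. A and §3] [cite: Greenberg1999LNM, Conj. 1.11] -/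
theorem fineResidualFinite_of_signedMuVanishingAtTwoPlus (h : SignedMuVanishingAtTwoPlus) :
    ∀ (W : WeierstrassCurve ℚ) [W.IsElliptic] [W.IsGloballyMinimal], ¬ W.HasCM → W.analyticRank = 0 →
      GoodSS W 2 → W.frobeniusTrace 2 = 0 → W.Δ < 0 →
      ∀ (κ : ZpExtension ℚ 2), κ.IsCyclotomic → {s : W.fineSelmerInfty κ | 2 • s = 0}.Finite :=
  fineResidualFinite_of_signedMuSeedAtTwoPlus (signedMuSeedAtTwoPlus_of_signedMuVanishingAtTwoPlus h)

end Summit.BirchSwinnertonDyer.BirchSwinnertonDyer.Theorems.SignedMuAtTwo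

end
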